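import Mathlib
import HarnessLib
import Summits.Ventures.LatticeQCDFlow.Exactness.U1ExactForceWilson

/-!
# `U(1)` rung — THE WORK IDENTITY: along a drift `t ↦ e^{ictp}·V` any pulled-back action `S` has derivative `κ⁻¹ Σ_e g(e^{icsp}·V)_e · p_e`, where `g_e = κ·∂_e(S∘drift)(0)` is the exact (autodiff) force — hence `|κ|·|S(e^{icp}·V) − S(V)| ≤ g_max · Σ_e |p_e|`

HONEST FRAMING: exact (Metropolis-corrected) sampling algorithms for lattice gauge theory;
figures of merit are autocorrelation/cost numbers at stated couplings and volumes; no
continuum-physics claim.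

Venture `LatticeQCDFlow` (cell pub-lqcd), topic `Exactness`; FANOUT row 14 (`eng-flowhmc`, engine
`latflow.fthmc`, family B, `U(1)` rung: momenta `p_e ∈ ℝ`, drift `V_e ← e^{icεp_e} V_e`, FT-HMC force
`g(V)_e = κ · fderiv (p ↦ S̃(e^{icp}·V)) 0 (δ_e)` with `S̃ = β S_W∘F − log J`, `U1ExactForceWilson`,
`U1WilsonFlowLOExactForceLipschitz`).  NEW WORK of the cell over Mathlib (`Circle.exp_add`, the mean value
inequality `norm_image_sub_le_of_norm_deriv_le_segment'`); nothing is cited as a fact; no number.  The `SU(2)`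
twin is `SU2ExactForceWork`.  Here `S : GaugeConfig d L U(1) → ℝ` is ARBITRARY (the FT action of any member,
or `β S_W` itself):

* **`u1Drift_add_smul`** — the drift is a one-parameter group linkwise: `e^{ic(h+s)p}·V = e^{ichp}·(e^{icsp}·V)`;
* **`u1ExactForce_is_gradient`** — `κ · D(p ↦ S(e^{icp}·V))(0)[δ] = Σ_e g(V)_e · δ_e`: the coordinatewise force
  assembles to the full differential (linearity only; both sides are built from the same `fderiv … 0`);
* **`hasDerivAt_action_u1Drift`** — if `p ↦ S(e^{icp}·W)` is differentiable at `0` for every `W` (typed for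
  `β S_W` in `U1ExactForceWilson.differentiableAt_wilsonAction_circleDrift`, for the LO member's FT action in the
  `U1SubstepForce*` chain), then `d/dt|_{t=s} κ·S(e^{ictp}·V) = Σ_e g(e^{icsp}·V)_e · p_e` — THE WORK IDENTITY;
* **`abs_action_u1Drift_sub_le`** — hence with `|g(W)_e| ≤ g_max` everywhere,
  `|κ|·|S(e^{icp}·V) − S(V)| ≤ g_max · Σ_e |p_e|`: over one leapfrog drift of momenta `p` for time `ε` the
  potential changes by at most `ε·g_max·Σ|p_e|/|κ|` (with `U1WilsonFlowLOExactForceLipschitz`'s explicit,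
  volume-independent `g_max = (1+A)^n(b₀ + nu)` for the LO member).

* **`dist_u1Drift_le`**, **`abs_action_u1Drift_sub_linear_le`** (§3) — the drift moves the field by at most
  `|c|·‖p‖·|t − t'|` in the sup metric, so a `K`-Lipschitz force (explicit `K` for the LO member in
  `U1WilsonFlowLOExactForceLipschitz`) gives FIRST-ORDER TAYLOR WITH AN EXPLICIT SECOND-ORDER REMAINDER:
  `|κ·(S(e^{icp}·V) − S(V)) − Σ_e g(V)_e p_e| ≤ |c|·K·‖p‖·(Σ_e|p_e|)/2` — over one leapfrog drift of momenta
  `εp` the potential deviates from its linearisation by `O(ε²)` with the constant in front explicit.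

NOT CLAIMED: the assembled energy error of a whole leapfrog trajectory and the acceptance-vs-step-size law
(the kick half-steps and the sum over `n` steps are the sequel); floating point; any number.
-/

noncomputable section

namespace Summit.Ventures.LatticeQCDFlow.Exactness

open Set MeasureTheory
open Literature.MathematicalPhysics.QuantumFieldTheory Literature.MathematicalPhysics.QuantumLattice

variable {d L : ℕ}

/-! ## §1 The drift is a one-parameter group, link by link -/

/-- **`e^{ic(h+s)p}·V = e^{ichp}·(e^{icsp}·V)`** linkwise. -/
theorem u1Drift_add_smul (c : ℝ) (V : GaugeConfig d L Circle) (p : Edge d L → ℝ) (h s : ℝ) :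
    ((fun i : Edge d L => Circle.exp (c * ((h + s) • p) i)) * V) =
      ((fun i : Edge d L => Circle.exp (c * (h • p) i)) * ((fun i : Edge d L => Circle.exp (c * (s • p) i)) * V)) := by
  funext i
  simp only [Pi.mul_apply, Pi.smul_apply, smul_eq_mul, ← mul_assoc, ← Circle.exp_add]
  congr 1
  · congr 1; ring

/-! ## §2 The force is the gradient; the work identity; the mean-value bound -/

section Work

variable [NeZero L]

/-- **THE COORDINATEWISE FORCE ASSEMBLES TO THE FULL DIFFERENTIAL**:
`κ · D(p ↦ S(e^{icp}·V))(0)[δ] = Σ_e (κ · D(p ↦ S(e^{icp}·V))(0)[e_e]) · δ_e`. -/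
theorem u1ExactForce_is_gradient (S : GaugeConfig d L Circle → ℝ) (c κ : ℝ) (V : GaugeConfig d L Circle)
    (δ : Edge d L → ℝ) :
    κ * fderiv ℝ (fun p : (Edge d L → ℝ) => S ((fun i : Edge d L => Circle.exp (c * p i)) * V)) 0 δ =
      ∑ e, (κ * fderiv ℝ (fun p : (Edge d L → ℝ) => S ((fun i : Edge d L => Circle.exp (c * p i)) * V)) 0 (Pi.single e 1)) * δ e := by
  set T := fderiv ℝ (fun p : (Edge d L → ℝ) => S ((fun i : Edge d L => Circle.exp (c * p i)) * V)) 0 with hT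
  have hδ : δ = ∑ e, δ e • (Pi.single e (1 : ℝ) : Edge d L → ℝ) := by
    funext i
    simp only [Finset.sum_apply, Pi.smul_apply, Pi.single_apply, smul_eq_mul, mul_ite, mul_one, mul_zero,
      Finset.sum_ite_eq, Finset.mem_univ, if_true]
  conv_lhs => rw [hδ]
  rw [map_sum, Finset.mul_sum]
  refine Finset.sum_congr rfl fun e _ => ?_
  rw [map_smul, smul_eq_mul]
  ring

/-- **THE WORK IDENTITY** on the `U(1)` rung: along the drift `t ↦ e^{ictp}·V`, for ANY action `S`
differentiable along drifts at zero momentum, `d/dt|_{t=s} κ·S(e^{ictp}·V) = Σ_e g(e^{icsp}·V)_e · p_e`. -/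
theorem hasDerivAt_action_u1Drift (S : GaugeConfig d L Circle → ℝ) (c κ : ℝ)
    (hd : ∀ W : GaugeConfig d L Circle, DifferentiableAt ℝ (fun p : (Edge d L → ℝ) => S ((fun i : Edge d L => Circle.exp (c * p i)) * W)) 0)
    (V : GaugeConfig d L Circle) (p : Edge d L → ℝ) (s : ℝ) :
    HasDerivAt (fun t : ℝ => κ * S ((fun i : Edge d L => Circle.exp (c * (t • p) i)) * V))
      (∑ e, (κ * fderiv ℝ (fun q : (Edge d L → ℝ) => S ((fun i : Edge d L => Circle.exp (c * q i)) *
          ((fun i : Edge d L => Circle.exp (c * (s • p) i)) * V))) 0 (Pi.single e 1)) * p e) s := by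
  -- chain rule at the current configuration `W = e^{icsp}·V`
  have hinner : HasDerivAt (fun t : ℝ => (t - s) • p) p s := by
    simpa using ((hasDerivAt_id s).sub_const s).smul_const p
  have h0 : (fun t : ℝ => (t - s) • p) s = 0 := by simp
  have hG : HasFDerivAt (fun q : (Edge d L → ℝ) => S ((fun i : Edge d L => Circle.exp (c * q i)) *
          ((fun i : Edge d L => Circle.exp (c * (s • p) i)) * V)))
      (fderiv ℝ (fun q : (Edge d L → ℝ) => S ((fun i : Edge d L => Circle.exp (c * q i)) *
          ((fun i : Edge d L => Circle.exp (c * (s • p) i)) * V))) 0) ((fun t : ℝ => (t - s) • p) s) := by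
    rw [h0]
    exact (hd _).hasFDerivAt
  have hfin := (hG.comp_hasDerivAt s hinner).const_mul κ
  rw [u1ExactForce_is_gradient S c κ _ p] at hfin
  have hfeq : (fun t : ℝ => κ * S ((fun i : Edge d L => Circle.exp (c * (t • p) i)) * V)) =
      fun y : ℝ => κ * ((fun q : (Edge d L → ℝ) => S ((fun i : Edge d L => Circle.exp (c * q i)) *
          ((fun i : Edge d L => Circle.exp (c * (s • p) i)) * V))) ∘ fun t : ℝ => (t - s) • p) y := by
    funext t
    simp only [Function.comp_apply]
    rw [← u1Drift_add_smul c V p (t - s) s, sub_add_cancel]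
  rw [hfeq]
  exact hfin

/-- **THE MEAN-VALUE BOUND ALONG A `U(1)` DRIFT**: with `|g(W)_e| ≤ g_max` for all `W, e`,
`|κ|·|S(e^{icp}·V) − S(V)| ≤ g_max · Σ_e |p_e|`. -/
theorem abs_action_u1Drift_sub_le (S : GaugeConfig d L Circle → ℝ) (c κ : ℝ)
    (hd : ∀ W : GaugeConfig d L Circle, DifferentiableAt ℝ (fun p : (Edge d L → ℝ) => S ((fun i : Edge d L => Circle.exp (c * p i)) * W)) 0)
    {gmax : ℝ} (hg : ∀ (W : GaugeConfig d L Circle) (e : Edge d L),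
      |κ * fderiv ℝ (fun q : (Edge d L → ℝ) => S ((fun i : Edge d L => Circle.exp (c * q i)) * W)) 0 (Pi.single e 1)| ≤ gmax)
    (V : GaugeConfig d L Circle) (p : Edge d L → ℝ) :
    |κ| * |S ((fun i : Edge d L => Circle.exp (c * p i)) * V) - S V| ≤ gmax * ∑ e, |p e| := by
  have hderiv : ∀ t ∈ Icc (0 : ℝ) 1, HasDerivWithinAt (fun t : ℝ => κ * S ((fun i : Edge d L => Circle.exp (c * (t • p) i)) * V))
      ((fun t : ℝ => ∑ e, (κ * fderiv ℝ (fun q : (Edge d L → ℝ) => S ((fun i : Edge d L => Circle.exp (c * q i)) *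
          ((fun i : Edge d L => Circle.exp (c * (t • p) i)) * V))) 0 (Pi.single e 1)) * p e) t) (Icc (0 : ℝ) 1) t :=
    fun t _ => (hasDerivAt_action_u1Drift S c κ hd V p t).hasDerivWithinAt
  have hbound : ∀ t ∈ Ico (0 : ℝ) 1, ‖(fun t : ℝ => ∑ e, (κ * fderiv ℝ (fun q : (Edge d L → ℝ) => S ((fun i : Edge d L => Circle.exp (c * q i)) *
          ((fun i : Edge d L => Circle.exp (c * (t • p) i)) * V))) 0 (Pi.single e 1)) * p e) t‖ ≤ gmax * ∑ e, |p e| := by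
    intro t _
    refine (norm_sum_le _ _).trans ?_
    rw [Finset.mul_sum]
    refine Finset.sum_le_sum fun e _ => ?_
    rw [Real.norm_eq_abs, abs_mul]
    exact mul_le_mul_of_nonneg_right (hg _ e) (abs_nonneg _)
  have h := norm_image_sub_le_of_norm_deriv_le_segment' hderiv hbound 1 (right_mem_Icc.2 zero_le_one)
  have h1 : (fun i : Edge d L => Circle.exp (c * ((1 : ℝ) • p) i)) * V = (fun i : Edge d L => Circle.exp (c * p i)) * V := by
    simp only [one_smul]
  have h0 : (fun i : Edge d L => Circle.exp (c * ((0 : ℝ) • p) i)) * V = V := by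
    funext i
    simp only [Pi.mul_apply, Pi.smul_apply, smul_eq_mul, zero_mul, mul_zero, Circle.exp_zero, one_mul]
  simp only [h1, h0, sub_zero, mul_one] at h
  rw [← mul_sub, norm_mul, Real.norm_eq_abs, Real.norm_eq_abs] at h
  exact h

/-! ## §3 Taylor to first order with an explicit second-order remainder: the energy error of the potential over one drift -/

/-- **The drift moves every link by at most `|c|·‖p‖·|t − t'|`** (sup metric on `U(1)^{links}`). -/
theorem dist_u1Drift_le (c : ℝ) (V : GaugeConfig d L Circle) (p : Edge d L → ℝ) (t t' : ℝ) :
    dist ((fun i : Edge d L => Circle.exp (c * (t • p) i)) * V) ((fun i : Edge d L => Circle.exp (c * (t' • p) i)) * V) ≤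
      |c| * ‖p‖ * |t - t'| := by
  refine (dist_pi_le_iff (by positivity)).2 fun i => ?_
  rw [Pi.mul_apply, Pi.mul_apply]
  have hdd : dist (Circle.exp (c * (t • p) i) * V i) (Circle.exp (c * (t' • p) i) * V i) =
      dist (((Circle.exp (c * (t • p) i) * V i : Circle)) : ℂ) (((Circle.exp (c * (t' • p) i) * V i : Circle)) : ℂ) := rfl
  rw [hdd, dist_eq_norm]
  have hV : ‖((V i : Circle) : ℂ)‖ = 1 := Circle.norm_coe (V i)
  rw [Circle.coe_mul, Circle.coe_mul, ← sub_mul, norm_mul, hV, mul_one, Circle.coe_exp, Circle.coe_exp]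
  have hfac : Complex.exp (↑(c * (t • p) i) * Complex.I) - Complex.exp (↑(c * (t' • p) i) * Complex.I) =
      Complex.exp (↑(c * (t' • p) i) * Complex.I) * (Complex.exp (Complex.I * ↑(c * p i * (t - t'))) - 1) := by
    rw [mul_sub, mul_one, ← Complex.exp_add]
    congr 2
    simp only [Pi.smul_apply, smul_eq_mul]
    push_cast
    ring
  rw [hfac, norm_mul, Complex.norm_exp_ofReal_mul_I, one_mul]
  refine (Real.norm_exp_I_mul_ofReal_sub_one_le).trans ?_
  rw [Real.norm_eq_abs, abs_mul, abs_mul]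
  have hp : |p i| ≤ ‖p‖ := by simpa only [Real.norm_eq_abs] using norm_le_pi_norm p i
  calc |c| * |p i| * |t - t'| ≤ |c| * ‖p‖ * |t - t'| := by gcongr

/-- **FIRST-ORDER TAYLOR ALONG A `U(1)` DRIFT WITH AN EXPLICIT SECOND-ORDER REMAINDER**: if the force is
`K`-Lipschitz in the sup metric (typed with an explicit, volume-independent `K` for the LO member in
`U1WilsonFlowLOExactForceLipschitz`), then
`|κ·(S(e^{icp}·V) − S(V)) − Σ_e g(V)_e p_e| ≤ (|c|·K·‖p‖·Σ_e|p_e|)/2` — over one leapfrog drift of momenta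
`εp` the potential's deviation from its linearisation is `O(ε²)` with the constant in front EXPLICIT. -/
theorem abs_action_u1Drift_sub_linear_le (S : GaugeConfig d L Circle → ℝ) (c κ : ℝ)
    (hd : ∀ W : GaugeConfig d L Circle, DifferentiableAt ℝ (fun p : (Edge d L → ℝ) => S ((fun i : Edge d L => Circle.exp (c * p i)) * W)) 0)
    {K : ℝ} (hK0 : 0 ≤ K)
    (hK : ∀ (W W' : GaugeConfig d L Circle) (e : Edge d L),
      |κ * fderiv ℝ (fun q : (Edge d L → ℝ) => S ((fun i : Edge d L => Circle.exp (c * q i)) * W)) 0 (Pi.single e 1) -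
        κ * fderiv ℝ (fun q : (Edge d L → ℝ) => S ((fun i : Edge d L => Circle.exp (c * q i)) * W')) 0 (Pi.single e 1)| ≤ K * dist W W')
    (V : GaugeConfig d L Circle) (p : Edge d L → ℝ) :
    |κ * (S ((fun i : Edge d L => Circle.exp (c * p i)) * V) - S V) -
        ∑ e, (κ * fderiv ℝ (fun q : (Edge d L → ℝ) => S ((fun i : Edge d L => Circle.exp (c * q i)) * V)) 0 (Pi.single e 1)) * p e| ≤
      |c| * K * ‖p‖ * (∑ e, |p e|) / 2 := by
  -- the path, its derivative φ and φ's Lipschitz constant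
  set f : ℝ → ℝ := fun t => κ * S ((fun i : Edge d L => Circle.exp (c * (t • p) i)) * V) with hf
  set φ : ℝ → ℝ := fun t => ∑ e, (κ * fderiv ℝ (fun q : (Edge d L → ℝ) => S ((fun i : Edge d L => Circle.exp (c * q i)) *
          ((fun i : Edge d L => Circle.exp (c * (t • p) i)) * V))) 0 (Pi.single e 1)) * p e with hφ
  set Lφ : ℝ := |c| * K * ‖p‖ * ∑ e, |p e| with hL
  have hderiv : ∀ t, HasDerivAt f (φ t) t := fun t => hasDerivAt_action_u1Drift S c κ hd V p t
  have hLip : ∀ t t' : ℝ, |φ t - φ t'| ≤ Lφ * |t - t'| := by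
    intro t t'
    rw [hφ]
    simp only
    rw [← Finset.sum_sub_distrib]
    refine (Finset.abs_sum_le_sum_abs _ _).trans ?_
    have hdist := dist_u1Drift_le c V p t t'
    calc ∑ e, |(κ * fderiv ℝ (fun q : (Edge d L → ℝ) => S ((fun i : Edge d L => Circle.exp (c * q i)) *
              ((fun i : Edge d L => Circle.exp (c * (t • p) i)) * V))) 0 (Pi.single e 1)) * p e -
            (κ * fderiv ℝ (fun q : (Edge d L → ℝ) => S ((fun i : Edge d L => Circle.exp (c * q i)) *
              ((fun i : Edge d L => Circle.exp (c * (t' • p) i)) * V))) 0 (Pi.single e 1)) * p e|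
        ≤ ∑ e, K * (|c| * ‖p‖ * |t - t'|) * |p e| := by
          refine Finset.sum_le_sum fun e _ => ?_
          rw [← sub_mul, abs_mul]
          exact mul_le_mul_of_nonneg_right ((hK _ _ e).trans (mul_le_mul_of_nonneg_left hdist hK0)) (abs_nonneg _)
      _ = Lφ * |t - t'| := by rw [hL, ← Finset.mul_sum]; ring
  have hL0 : 0 ≤ Lφ := by rw [hL]; positivity
  -- values at the endpoints
  have hf0 : f 0 = κ * S V := by
    rw [hf]
    simp only [zero_smul, Pi.zero_apply, mul_zero, Circle.exp_zero]
    congr 2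
    funext i
    simp only [Pi.mul_apply, one_mul]
  have hf1 : f 1 = κ * S ((fun i : Edge d L => Circle.exp (c * p i)) * V) := by
    rw [hf]
    simp only [one_smul]
  have hφ0 : φ 0 = ∑ e, (κ * fderiv ℝ (fun q : (Edge d L → ℝ) => S ((fun i : Edge d L => Circle.exp (c * q i)) * V)) 0 (Pi.single e 1)) * p e := by
    rw [hφ]
    simp only [zero_smul, Pi.zero_apply, mul_zero, Circle.exp_zero]
    congr 1
    funext e
    congr 4
    funext q
    congr 2
    funext i
    simp only [Pi.mul_apply, one_mul]
  -- comparison functions G (upper) and H (lower)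
  have hG : ∀ t, HasDerivAt (fun x => f x - x * φ 0 - Lφ / 2 * (x * x)) (φ t - φ 0 - Lφ * t) t := by
    intro t
    have h1 := ((hderiv t).sub (hasDerivAt_mul_const (φ 0))).sub
      (((hasDerivAt_id' t).mul (hasDerivAt_id' t)).const_mul (Lφ / 2))
    exact h1.congr_deriv (by ring)
  have hH : ∀ t, HasDerivAt (fun x => f x - x * φ 0 + Lφ / 2 * (x * x)) (φ t - φ 0 + Lφ * t) t := by
    intro t
    have h1 := ((hderiv t).sub (hasDerivAt_mul_const (φ 0))).add
      (((hasDerivAt_id' t).mul (hasDerivAt_id' t)).const_mul (Lφ / 2))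
    exact h1.congr_deriv (by ring)
  have hGmono : (fun x => f x - x * φ 0 - Lφ / 2 * (x * x)) 1 - (fun x => f x - x * φ 0 - Lφ / 2 * (x * x)) 0 ≤ 0 * (1 - 0) := by
    refine (convex_Icc (0 : ℝ) 1).image_sub_le_mul_sub_of_deriv_le
      (fun t _ => (hG t).continuousAt.continuousWithinAt) (fun t _ => (hG t).differentiableAt.differentiableWithinAt)
      (fun t ht => ?_) 0 (left_mem_Icc.2 zero_le_one) 1 (right_mem_Icc.2 zero_le_one) zero_le_one
    rw [interior_Icc] at ht
    rw [(hG t).deriv]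
    have := hLip t 0
    rw [sub_zero, abs_of_pos ht.1] at this
    linarith [le_abs_self (φ t - φ 0)]
  have hHmono : 0 * (1 - 0) ≤ (fun x => f x - x * φ 0 + Lφ / 2 * (x * x)) 1 - (fun x => f x - x * φ 0 + Lφ / 2 * (x * x)) 0 := by
    refine (convex_Icc (0 : ℝ) 1).mul_sub_le_image_sub_of_le_deriv
      (fun t _ => (hH t).continuousAt.continuousWithinAt) (fun t _ => (hH t).differentiableAt.differentiableWithinAt)
      (fun t ht => ?_) 0 (left_mem_Icc.2 zero_le_one) 1 (right_mem_Icc.2 zero_le_one) zero_le_one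
    rw [interior_Icc] at ht
    rw [(hH t).deriv]
    have := hLip t 0
    rw [sub_zero, abs_of_pos ht.1] at this
    linarith [neg_abs_le (φ t - φ 0)]
  norm_num at hGmono hHmono
  rw [mul_sub, ← hf1, ← hf0, ← hφ0, abs_le]
  constructor <;> linarith [hGmono, hHmono]

end Work

end Summit.Ventures.LatticeQCDFlow.Exactness
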